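import Mathlib
import Summits.Ventures.PercRepro2.PMK5Deg3Kernel
import Summits.Ventures.PercRepro2.PMK5Deg4Kernel
import Summits.Ventures.PercRepro2.PMK5Deg4Kernel5
import Summits.Ventures.PercRepro2.PMK5Deg5Kernel
import Summits.Ventures.PercRepro2.PMK5Deg5Kernel6
import Summits.Ventures.PercRepro2.PMK5Deg5LitsK60

/-!
# The table literals of `K₆`, six sliced edges, and their kernel certification, part 5 of 0–8
(blind cell PercRepro2, mine-2 g29; the degree-5 rung, `PMK5Deg5Kernel6.lean`)

`Lk6 i a b c d e f` is the `512`-bit vector of the `i`-th of the nineteen tables of `K₆` restricted to the edges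
`9 ↦ a`, `10 ↦ b`, `11 ↦ c`, `12 ↦ d`, `13 ↦ e`, `14 ↦ f` (bit `idx2 ω` = the table at `ext6 ω a b c d e f`), generated by
mining/mine-2/code/g29/lits6.c.  **`litOK_k6 : LitOK Lk6`** (part 8) certifies all `1216` literals against the tables in
the kernel (`lit_k6_ffffff`, …, `lit_k6_tttttt`: one `decide +kernel` per restriction, the bit tree `bits9` evaluated on the
`512` nine-edge configurations of each; part 0 = the literals (statement-only), parts 1–8 = eight certifications each).
The `4096` slice certificates `CertS Lk6 j₁ … j₆` are `PMK5Deg5CertsK6*.lean`.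
-/

namespace Summit.Ventures.PercRepro2

namespace Deg5

namespace Six

set_option maxHeartbeats 0 in
set_option maxRecDepth 100000 in
/-- The literals of the restriction `ffffft` are the bit vectors of the restricted tables. -/
theorem lit_k6_ffffft : ∀ i : Fin 19, Lk6 i false false false false false true = bits9 (res6 (tab i) false false false false false true) := by
  decide +kernel

set_option maxHeartbeats 0 in
set_option maxRecDepth 100000 in
/-- The literals of the restriction `tfffft` are the bit vectors of the restricted tables. -/
theorem lit_k6_tfffft : ∀ i : Fin 19, Lk6 i true false false false false true = bits9 (res6 (tab i) true false false false false true) := by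
  decide +kernel

set_option maxHeartbeats 0 in
set_option maxRecDepth 100000 in
/-- The literals of the restriction `ftffft` are the bit vectors of the restricted tables. -/
theorem lit_k6_ftffft : ∀ i : Fin 19, Lk6 i false true false false false true = bits9 (res6 (tab i) false true false false false true) := by
  decide +kernel

set_option maxHeartbeats 0 in
set_option maxRecDepth 100000 in
/-- The literals of the restriction `ttffft` are the bit vectors of the restricted tables. -/
theorem lit_k6_ttffft : ∀ i : Fin 19, Lk6 i true true false false false true = bits9 (res6 (tab i) true true false false false true) := by
  decide +kernel

set_option maxHeartbeats 0 in
set_option maxRecDepth 100000 in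
/-- The literals of the restriction `fftfft` are the bit vectors of the restricted tables. -/
theorem lit_k6_fftfft : ∀ i : Fin 19, Lk6 i false false true false false true = bits9 (res6 (tab i) false false true false false true) := by
  decide +kernel

set_option maxHeartbeats 0 in
set_option maxRecDepth 100000 in
/-- The literals of the restriction `tftfft` are the bit vectors of the restricted tables. -/
theorem lit_k6_tftfft : ∀ i : Fin 19, Lk6 i true false true false false true = bits9 (res6 (tab i) true false true false false true) := by
  decide +kernel

set_option maxHeartbeats 0 in
set_option maxRecDepth 100000 in
/-- The literals of the restriction `fttfft` are the bit vectors of the restricted tables. -/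
theorem lit_k6_fttfft : ∀ i : Fin 19, Lk6 i false true true false false true = bits9 (res6 (tab i) false true true false false true) := by
  decide +kernel

set_option maxHeartbeats 0 in
set_option maxRecDepth 100000 in
/-- The literals of the restriction `tttfft` are the bit vectors of the restricted tables. -/
theorem lit_k6_tttfft : ∀ i : Fin 19, Lk6 i true true true false false true = bits9 (res6 (tab i) true true true false false true) := by
  decide +kernel


end Six

end Deg5

end Summit.Ventures.PercRepro2
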